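import Summits.CriticalPhenomena.PercolationContinuityZ3.Theorems.PercNearOneGluingNoHeavyLowerTailFatMinorityMajoritySplit
import HarnessLib

/-!
# `NoHeavyLowerTail` (stmt-CriticalPhenomena-4575), line fat-minority-linear — majority miss through a
# FIXED relay costs `2η` ("no favourite relay" is the obstruction)

Continuation of `…FatMinorityMajoritySplit` (same notation: relay set `A`, observer `o ∉ A`,
`η ≥ max P(a ↮ a')`, `MM` = the majority-miss event = off `o` some open cluster holds a strict majority
of the relays, `o` is joined to a relay but not to that cluster).  Results (sorry-free, elementary):

* `majorityStray_le` — for a FIXED relay `a'`: P(off `o` a relay-majority cluster exists, `a'` is not in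
  it, and `o` misses it) `≤ 2 · max_a P(a' ↮ a)` (on the event `a'` is cut from every majority relay).
* `majorityMiss_inter_openConn_le` — `P(MM ∩ {o ↔ a'}) ≤ 2η` for every fixed relay `a'`; hence
  `P(MM) ≤ 2|A|η` by the union bound, and
* `majorityMiss_le_of_favourite` — if some fixed relay carries a fraction `θ` of `MM` then
  `P(MM) ≤ 2η/θ`.

So the registered stub `stub_fatMinorityLinear` (≡ `MajorityMiss` up to `+4`, previous file) is
exactly as hard as controlling a majority miss whose entrance relay MOVES with the configuration
(no relay carries a fixed fraction of the event): the "moving thin pocket at the observer" — the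
form in which this line hands the residual back to the crux (Kozma–Nitzan's pocket with few fingers,
localised at the observer's edge star).
-/

noncomputable section

namespace Summit.CriticalPhenomena.PercolationContinuityZ3.Theorems

open MeasureTheory Set Literature.Probability.LatticeModels Literature.Probability.Percolation
open Summit.CriticalPhenomena.PercolationContinuityZ3.Theses.PercNearOneGluing
open scoped Classical BigOperators

/-! ## Majority miss through a fixed relay

The obstruction sharpened: the majority-miss event is cheap as soon as the relay through which the
observer enters the minority is FIXED; its whole difficulty is that this relay moves with the
configuration ("no favourite relay"). -/

/-- Transitivity of `{x ↔ y in S}` (from the definition). [folklore] -/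
theorem openConnIn_trans_fm {n : ℕ} {ω : BondConfig (Fin n)} {S : Set (Fin n)} {x y z : Fin n}
    (h₁ : ω ∈ (openConnIn S x y : Set (BondConfig (Fin n))))
    (h₂ : ω ∈ (openConnIn S y z : Set (BondConfig (Fin n)))) :
    ω ∈ (openConnIn S x z : Set (BondConfig (Fin n))) := by
  obtain ⟨hx, hy, h₁⟩ := h₁
  obtain ⟨hy', hz, h₂⟩ := h₂
  exact ⟨hx, hz, h₁.trans h₂⟩

/-- Symmetry of `{x ↔ y in S}` (from the definition). [folklore] -/
theorem openConnIn_symm_fm {n : ℕ} {ω : BondConfig (Fin n)} {S : Set (Fin n)} {x y : Fin n}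
    (h : ω ∈ (openConnIn S x y : Set (BondConfig (Fin n)))) :
    ω ∈ (openConnIn S y x : Set (BondConfig (Fin n))) := by
  obtain ⟨hx, hy, h⟩ := h
  exact ⟨hy, hx, h.symm⟩

/-- **A fixed stray relay costs `2η`.** For a fixed relay `a' ∈ A`, the event "off `o` some cluster
holds a strict majority of the relays but not `a'`, and `o` is not joined to that cluster" has
probability `≤ 2 · max_{a ∈ A} P(a' ↮ a)`: on it `a'` is cut from every relay of the majority
cluster (a path from `a'` to the cluster avoiding `o` would put `a'` inside it, one through `o` would
join `o` to it), i.e. from more than `|A|/2` relays; first-moment counting. [folklore] -/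
theorem majorityStray_le {n : ℕ} (w : Sym2 (Fin n) → unitInterval) (A : Finset (Fin n))
    (o a' : Fin n) (η : ℝ) (ha' : a' ∈ A)
    (hpair : ∀ a ∈ A, (prodBernoulli w).real (openConn a' a : Set (BondConfig (Fin n)))ᶜ ≤ η) :
    (prodBernoulli w).real {ω : BondConfig (Fin n) | ∃ v : Fin n,
        A.card < 2 * (A.filter fun a => ω ∈ openConnIn (({o} : Set (Fin n))ᶜ) v a).card ∧
        ω ∉ (openConnIn (({o} : Set (Fin n))ᶜ) v a' : Set (BondConfig (Fin n))) ∧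
        ω ∉ (openConn o v : Set (BondConfig (Fin n)))} ≤ 2 * η := by
  have hmeas : ∀ s : Set (BondConfig (Fin n)), MeasurableSet s :=
    fun _ => MeasurableSet.of_discrete
  set P := prodBernoulli w with hP
  set D : Set (BondConfig (Fin n)) := {ω : BondConfig (Fin n) | ∃ v : Fin n,
      A.card < 2 * (A.filter fun a => ω ∈ openConnIn (({o} : Set (Fin n))ᶜ) v a).card ∧
      ω ∉ (openConnIn (({o} : Set (Fin n))ᶜ) v a' : Set (BondConfig (Fin n))) ∧
      ω ∉ (openConn o v : Set (BondConfig (Fin n)))} with hD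
  set m : ℝ := (A.card : ℝ) with hm
  have hmpos : 0 < m := by rw [hm]; exact_mod_cast Finset.card_pos.2 ⟨a', ha'⟩
  have hcount : m / 2 * P.real D ≤
      ∑ a ∈ A, P.real (D ∩ (openConn a' a : Set (BondConfig (Fin n)))ᶜ) := by
    refine halfLeSevenForms_mul_measureReal_le_sum_inter P A
      (fun a => (openConn a' a : Set (BondConfig (Fin n)))ᶜ) (fun _ _ => hmeas _) (hmeas D)
      (m / 2) fun ω hω => ?_
    have hind : ∀ a ∈ A,
        ((openConn a' a : Set (BondConfig (Fin n)))ᶜ).indicator (fun _ => (1 : ℝ)) ω =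
          if ¬ ω ∈ (openConn a' a : Set (BondConfig (Fin n))) then (1 : ℝ) else 0 := by
      intro a _
      by_cases h' : ω ∈ (openConn a' a : Set (BondConfig (Fin n)))
      · rw [if_neg (not_not.2 h'), Set.indicator_of_notMem (Set.notMem_compl_iff.2 h')]
      · rw [if_pos h', Set.indicator_of_mem (show ω ∈ (openConn a' a : Set (BondConfig (Fin n)))ᶜ
          from h')]
    rw [Finset.sum_congr rfl hind, Finset.sum_boole]
    obtain ⟨v, hmaj, hva', hov⟩ := hω
    -- every relay of the majority cluster is cut from `a'`
    have hsub : (A.filter fun a => ω ∈ openConnIn (({o} : Set (Fin n))ᶜ) v a) ⊆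
        (A.filter fun a => ¬ ω ∈ (openConn a' a : Set (BondConfig (Fin n)))) := by
      intro a ha
      rw [Finset.mem_filter] at ha ⊢
      refine ⟨ha.1, fun ha'a => ?_⟩
      by_cases hoa' : ω ∈ (openConn o a' : Set (BondConfig (Fin n)))
      · have h1 : (openGraph ω).Reachable o a' := hoa'
        have h2 : (openGraph ω).Reachable a' a := ha'a
        have h3 : (openGraph ω).Reachable v a := openConnIn_subset_openConn _ _ _ ha.2
        exact hov ((h1.trans h2).trans h3.symm)
      · have h4 := (openConn_iff_openConnIn_compl_of_not_openConn hoa').1 ha'a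
        exact hva' (openConnIn_trans_fm ha.2 (openConnIn_symm_fm h4))
    have hle := Finset.card_le_card hsub
    have hmaj' : m < 2 * ((A.filter fun a => ω ∈ openConnIn (({o} : Set (Fin n))ᶜ) v a).card : ℝ) := by
      rw [hm]; exact_mod_cast hmaj
    have hle' : ((A.filter fun a => ω ∈ openConnIn (({o} : Set (Fin n))ᶜ) v a).card : ℝ) ≤
        ((A.filter fun a => ¬ ω ∈ (openConn a' a : Set (BondConfig (Fin n)))).card : ℝ) := by
      exact_mod_cast hle
    linarith
  have hsum : ∑ a ∈ A, P.real (D ∩ (openConn a' a : Set (BondConfig (Fin n)))ᶜ) ≤ m * η := by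
    calc ∑ a ∈ A, P.real (D ∩ (openConn a' a : Set (BondConfig (Fin n)))ᶜ)
        ≤ ∑ a ∈ A, η := Finset.sum_le_sum fun a ha =>
          (measureReal_mono Set.inter_subset_right (measure_ne_top _ _)).trans (hpair a ha)
      _ = m * η := by rw [Finset.sum_const, nsmul_eq_mul, hm]
  have h2 : m / 2 * P.real D ≤ m / 2 * (2 * η) := by
    calc m / 2 * P.real D ≤ m * η := hcount.trans hsum
      _ = m / 2 * (2 * η) := by ring
  exact le_of_mul_le_mul_left h2 (by positivity)

/-- **Majority miss through a fixed relay.** For every FIXED relay `a' ∈ A`,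
`P(MM ∩ {o ↔ a'}) ≤ 2 · max_{a ∈ A} P(a' ↮ a)`: if `o ↔ a'` while `o` misses the majority cluster
then `a'` lies outside it.  Consequently `P(MM) ≤ 2|A|η` by the union bound, and the whole content of
the majority-miss bound (≡ the stub) is that the relay through which the observer enters the
minority MOVES with the configuration. [folklore] -/
theorem majorityMiss_inter_openConn_le {n : ℕ} (w : Sym2 (Fin n) → unitInterval)
    (A : Finset (Fin n)) (o a' : Fin n) (η : ℝ) (ha' : a' ∈ A)
    (hpair : ∀ a ∈ A, (prodBernoulli w).real (openConn a' a : Set (BondConfig (Fin n)))ᶜ ≤ η) :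
    (prodBernoulli w).real ({ω : BondConfig (Fin n) |
        ω ∈ (⋃ a ∈ A, (openConn o a : Set (BondConfig (Fin n)))) ∧
        ∃ v : Fin n, A.card < 2 * (A.filter fun a =>
          ω ∈ openConnIn (({o} : Set (Fin n))ᶜ) v a).card ∧
          ω ∉ (openConn o v : Set (BondConfig (Fin n)))} ∩
        (openConn o a' : Set (BondConfig (Fin n)))) ≤ 2 * η := by
  refine le_trans (measureReal_mono (fun ω hω => ?_) (measure_ne_top _ _))
    (majorityStray_le w A o a' η ha' hpair)
  obtain ⟨⟨-, v, hmaj, hov⟩, hoa'⟩ := hω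
  refine ⟨v, hmaj, fun hva' => hov ?_, hov⟩
  have h1 : (openGraph ω).Reachable o a' := hoa'
  have h2 : (openGraph ω).Reachable v a' := openConnIn_subset_openConn _ _ _ hva'
  exact h1.trans h2.symm

/-- **A favourite relay suffices.** If a fixed relay `a⋆ ∈ A` carries a fraction `θ > 0` of the
majority-miss event (`θ · P(MM) ≤ P(MM ∩ {o ↔ a⋆})`), then `P(MM) ≤ 2η/θ`. [folklore] -/
theorem majorityMiss_le_of_favourite {n : ℕ} (w : Sym2 (Fin n) → unitInterval)
    (A : Finset (Fin n)) (o aStar : Fin n) (η θ : ℝ) (hθ : 0 < θ) (haStar : aStar ∈ A)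
    (hpair : ∀ a ∈ A, (prodBernoulli w).real (openConn aStar a : Set (BondConfig (Fin n)))ᶜ ≤ η)
    (hfav : θ * (prodBernoulli w).real {ω : BondConfig (Fin n) |
        ω ∈ (⋃ a ∈ A, (openConn o a : Set (BondConfig (Fin n)))) ∧
        ∃ v : Fin n, A.card < 2 * (A.filter fun a =>
          ω ∈ openConnIn (({o} : Set (Fin n))ᶜ) v a).card ∧
          ω ∉ (openConn o v : Set (BondConfig (Fin n)))} ≤
      (prodBernoulli w).real ({ω : BondConfig (Fin n) |
        ω ∈ (⋃ a ∈ A, (openConn o a : Set (BondConfig (Fin n)))) ∧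
        ∃ v : Fin n, A.card < 2 * (A.filter fun a =>
          ω ∈ openConnIn (({o} : Set (Fin n))ᶜ) v a).card ∧
          ω ∉ (openConn o v : Set (BondConfig (Fin n)))} ∩
        (openConn o aStar : Set (BondConfig (Fin n))))) :
    (prodBernoulli w).real {ω : BondConfig (Fin n) |
        ω ∈ (⋃ a ∈ A, (openConn o a : Set (BondConfig (Fin n)))) ∧
        ∃ v : Fin n, A.card < 2 * (A.filter fun a =>
          ω ∈ openConnIn (({o} : Set (Fin n))ᶜ) v a).card ∧
          ω ∉ (openConn o v : Set (BondConfig (Fin n)))} ≤ 2 * η / θ := by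
  have h := majorityMiss_inter_openConn_le w A o aStar η haStar hpair
  rw [le_div_iff₀ hθ]
  linarith

end Summit.CriticalPhenomena.PercolationContinuityZ3.Theorems

end
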